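import Literature.AlgebraicGeometry.Resolution.FiniteBirationalNormal
import Literature.AlgebraicGeometry.Resolution.RegularLocalRingsNormal
import Literature.AlgebraicGeometry.Resolution.QuasiProjectiveResolution
import Literature.AlgebraicGeometry.Resolution.PrincipalizationToResolution
import Literature.AlgebraicGeometry.Resolution.ResolutionOfComponents
import Mathlib.AlgebraicGeometry.Morphisms.Finite
import Mathlib.AlgebraicGeometry.Morphisms.Proper
import Mathlib.AlgebraicGeometry.Pullbacks
import Mathlib.AlgebraicGeometry.IdealSheaf.Subscheme

/-!
# `WeightedInvariant.WeightedThesis`, line `datum-glued-split`: finite birational transfer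

Route `ResolutionOfSingularities/WeightedInvariant`, crux `WeightedThesis`
(stmt-ResolutionOfSingularities-0569), stub `stub_finiteBirationalTransfer` (RESHAPE 2, stub 4)
of the lead's skeleton `work/WeightedThesis.lean`, PROVED here (statement verbatim from the
ledger registration).

**Statement (folklore; Stacks 035Q / 0AB1; de Jong 1996, 4.20–4.21).** Let `φ : X → H` be a
finite birational morphism of integral schemes. If `H` admits a resolution of singularities
(`Scheme.HasResolution`: a proper birational morphism from a regular scheme), then so does `X`.

**Proof.** Let `π : H̃ → H` be a resolution; `H̃` is integral (reduced since regular, irreducible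
since birational onto the irreducible `H`) and normal (regular local rings are integrally closed,
`isIntegrallyClosed_of_isRegularLocalRing`). Let `W ⊆ H` be a non-empty open over which both
`π` and `φ` are isomorphisms, `P = H̃ ×_H X` with projections `p₁` (finite, base change of `φ`)
and `p₂` (proper, base change of `π`). Over `W` both projections restrict to isomorphisms
(`Scheme.Hom.isPullback_resLE`), so the open `O = p₁⁻¹(π⁻¹ W) = p₂⁻¹(φ⁻¹ W)` of `P` is a copy
of the non-empty open `π⁻¹ W` of `H̃`: reduced and irreducible. Let `Z` be the reduced closed
subscheme of `P` on the closure of `O` (Mathlib's `vanishingIdeal`/`subscheme`); it is integral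
and contains `O` as a dense open (`Z ↪ P` is an isomorphism over `O`, a surjective closed
immersion onto a reduced scheme). Then `Z → H̃` is finite and birational (an isomorphism over
`π⁻¹ W`), hence an isomorphism (`isIso_of_isFinite_of_isBirational`), so `Z` is regular; and
`Z → X` is proper and an isomorphism over the dense open `φ⁻¹ W` with dense preimage
`Z ∩ O`: a resolution of `X`.
-/

noncomputable section

set_option linter.dupNamespace false -- mandated namespace of this single-conjunct summit

open CategoryTheory CategoryTheory.Limits AlgebraicGeometry TopologicalSpace Topology
  Literature.AlgebraicGeometry.Resolution

namespace Summit.ResolutionOfSingularities.ResolutionOfSingularities.Theorems.WeightedThesis.FiniteBirationalTransfer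

universe u

/-! ## Scheme glue -/

/-- A closed immersion restricts to an isomorphism over every open of the target which is
contained in its range and is reduced (as an open subscheme). [folklore] -/
theorem isIso_morphismRestrict_of_subset_range {C P : Scheme.{u}} (ι : C ⟶ P)
    [IsClosedImmersion ι] (O : P.Opens) [IsReduced (O : Scheme.{u})]
    (hO : (O : Set P) ⊆ Set.range ι) : IsIso (ι ∣_ O) := by
  haveI : IsClosedImmersion (ι ∣_ O) := IsZariskiLocalAtTarget.restrict ‹_› O
  haveI : Surjective (ι ∣_ O) := by
    refine ⟨fun x => ?_⟩
    obtain ⟨c, hc⟩ := hO x.2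
    refine ⟨⟨c, show ι c ∈ O by rw [hc]; exact x.2⟩, ?_⟩
    apply Subtype.ext
    rw [morphismRestrict_base_coe]
    exact hc
  exact isIso_of_isClosedImmersion_of_surjective _

/-- In a cartesian square `fst ≫ f = snd ≫ g`, if `g` is an isomorphism over the open `W` of the
base then `fst` is an isomorphism over `f⁻¹ W` (base change of an isomorphism). [folklore] -/
theorem isIso_morphismRestrict_of_isPullback {P X Y S : Scheme.{u}} {fst : P ⟶ X} {snd : P ⟶ Y}
    {f : X ⟶ S} {g : Y ⟶ S} (hP : IsPullback fst snd f g) (W : S.Opens) (hg : IsIso (g ∣_ W)) :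
    IsIso (fst ∣_ f ⁻¹ᵁ W) := by
  have hpre : fst ⁻¹ᵁ (f ⁻¹ᵁ W) = snd ⁻¹ᵁ (g ⁻¹ᵁ W) := by
    rw [← Scheme.Hom.comp_preimage, hP.w, Scheme.Hom.comp_preimage]
  have H := Scheme.Hom.isPullback_resLE hP (US := W) (UT := g ⁻¹ᵁ W) (UX := f ⁻¹ᵁ W) le_rfl
    le_rfl (UY := fst ⁻¹ᵁ (f ⁻¹ᵁ W)) (by rw [← hpre, inf_idem])
  have hg' : IsIso (g.resLE W (g ⁻¹ᵁ W) le_rfl) := by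
    rw [Scheme.Hom.resLE_eq_morphismRestrict]; exact hg
  have h := H.isIso_fst_of_isIso
  rwa [Scheme.Hom.resLE_eq_morphismRestrict] at h

/-- A scheme isomorphic to a non-empty open subscheme of an irreducible scheme is irreducible:
if `e : O ⟶ V` is an isomorphism onto the open subscheme `V ≠ ∅` of the irreducible `T`, then
`O` is an irreducible space (`e ≫ V ↪ T` is an open embedding). [folklore] -/
theorem irreducibleSpace_of_isIso_to_opens {O T : Scheme.{u}} [IrreducibleSpace T] (V : T.Opens)
    (e : O ⟶ (V : Scheme.{u})) [IsIso e] (hV : (V : Set T).Nonempty) : IrreducibleSpace O := by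
  obtain ⟨t, ht⟩ := hV
  haveI : Nonempty O := ⟨(Scheme.homeoOfIso (asIso e)).symm ⟨t, ht⟩⟩
  exact (e ≫ V.ι).isOpenEmbedding.irreducibleSpace

/-- The underlying set of an open subscheme which is an irreducible space is irreducible.
[folklore] -/
theorem isIrreducible_coe_of_irreducibleSpace {T : Scheme.{u}} (O : T.Opens)
    [IrreducibleSpace (O : Scheme.{u})] : IsIrreducible (O : Set T) := by
  rw [← Scheme.Opens.range_ι, ← Set.image_univ]
  exact (IrreducibleSpace.isIrreducible_univ _).image _ O.ι.continuous.continuousOn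

/-! ## The transfer -/

open Scheme.IdealSheafData in
/-- **The heart of the transfer.** Given a cartesian square `p₁ ≫ π = p₂ ≫ φ` of integral
schemes `X, H, H̃` with `p₁ : P → H̃` finite, `p₂ : P → X` proper, `H̃` regular with integrally
closed local rings, and a non-empty open `W ⊆ H` over which `π` and `φ` are isomorphisms, the
reduced closure `Z` of `p₁⁻¹(π⁻¹ W)` in `P` is isomorphic to `H̃` via `p₁` and resolves `X` via
`p₂`. [cite: DeJong1996, 4.20–4.21, pp. 73–74] -/
theorem hasResolution_of_isPullback {X H H' P : Scheme.{u}} [IsIntegral X] [IsIntegral H']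
    {φ : X ⟶ H} {π : H' ⟶ H} {p₁ : P ⟶ H'} {p₂ : P ⟶ X} (hP : IsPullback p₁ p₂ π φ)
    [IsFinite p₁] [IsProper p₂] (hnorm : ∀ y : H', IsIntegrallyClosed (H'.presheaf.stalk y))
    (hreg : Scheme.IsRegular H') (W : H.Opens) (hWne : (W : Set H).Nonempty)
    (hπW : IsIso (π ∣_ W)) (hφW : IsIso (φ ∣_ W)) : Scheme.HasResolution X := by
  obtain ⟨w, hw⟩ := hWne
  -- the open `O = p₁⁻¹(π⁻¹ W) = p₂⁻¹(φ⁻¹ W)` of `P`, over which both projections are isos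
  have hO : p₁ ⁻¹ᵁ (π ⁻¹ᵁ W) = p₂ ⁻¹ᵁ (φ ⁻¹ᵁ W) := by
    rw [← Scheme.Hom.comp_preimage, hP.w, Scheme.Hom.comp_preimage]
  have h₁ : IsIso (p₁ ∣_ π ⁻¹ᵁ W) := isIso_morphismRestrict_of_isPullback hP W hφW
  have h₂ : IsIso (p₂ ∣_ φ ⁻¹ᵁ W) := isIso_morphismRestrict_of_isPullback hP.flip W hπW
  -- `π⁻¹ W` and `φ⁻¹ W` are non-empty, hence dense
  have hVne : ((π ⁻¹ᵁ W : H'.Opens) : Set H').Nonempty :=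
    ⟨_, ((Scheme.homeoOfIso (asIso (π ∣_ W))).symm ⟨w, hw⟩).2⟩
  have hUne : ((φ ⁻¹ᵁ W : X.Opens) : Set X).Nonempty :=
    ⟨_, ((Scheme.homeoOfIso (asIso (φ ∣_ W))).symm ⟨w, hw⟩).2⟩
  have hVd : Dense ((π ⁻¹ᵁ W : H'.Opens) : Set H') := (π ⁻¹ᵁ W).isOpen.dense hVne
  have hUd : Dense ((φ ⁻¹ᵁ W : X.Opens) : Set X) := (φ ⁻¹ᵁ W).isOpen.dense hUne
  -- `O` is reduced, irreducible and non-empty (a copy of `π⁻¹ W ⊆ H̃`)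
  haveI : IsReduced H' := hreg.isReduced
  haveI : IsReduced ((p₁ ⁻¹ᵁ (π ⁻¹ᵁ W) : P.Opens) : Scheme.{u}) :=
    isReduced_of_isOpenImmersion (p₁ ∣_ π ⁻¹ᵁ W)
  haveI : IrreducibleSpace ((p₁ ⁻¹ᵁ (π ⁻¹ᵁ W) : P.Opens) : Scheme.{u}) :=
    irreducibleSpace_of_isIso_to_opens (π ⁻¹ᵁ W) (p₁ ∣_ π ⁻¹ᵁ W) hVne
  have hOirr : IsIrreducible ((p₁ ⁻¹ᵁ (π ⁻¹ᵁ W) : P.Opens) : Set P) :=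
    isIrreducible_coe_of_irreducibleSpace _
  obtain ⟨o, ho⟩ := hOirr.nonempty
  -- the reduced closed subscheme `Z` on the closure of `O`
  let T : Closeds P := ⟨closure ((p₁ ⁻¹ᵁ (π ⁻¹ᵁ W) : P.Opens) : Set P), isClosed_closure⟩
  haveI : IsIntegral (vanishingIdeal T).subscheme := isIntegral_subscheme_vanishingIdeal T
    hOirr.closure
  have hrange : Set.range (vanishingIdeal T).subschemeι = closure (p₁ ⁻¹ᵁ (π ⁻¹ᵁ W) : Set P) :=
    range_subschemeι_vanishingIdeal T
  -- `Z ↪ P` is an isomorphism over `O`, and `Z ∩ O` is dense in `Z`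
  have hιO : IsIso ((vanishingIdeal T).subschemeι ∣_ p₁ ⁻¹ᵁ (π ⁻¹ᵁ W)) :=
    isIso_morphismRestrict_of_subset_range _ _ (by rw [hrange]; exact subset_closure)
  have hZd : Dense (((vanishingIdeal T).subschemeι ⁻¹ᵁ (p₁ ⁻¹ᵁ (π ⁻¹ᵁ W)) :
      (vanishingIdeal T).subscheme.Opens) : Set (vanishingIdeal T).subscheme) := by
    have hoZ : o ∈ Set.range (vanishingIdeal T).subschemeι := by
      rw [hrange]; exact subset_closure ho
    obtain ⟨z, hz⟩ := hoZ
    exact ((vanishingIdeal T).subschemeι ⁻¹ᵁ (p₁ ⁻¹ᵁ (π ⁻¹ᵁ W))).isOpen.dense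
      ⟨z, show (vanishingIdeal T).subschemeι z ∈ p₁ ⁻¹ᵁ (π ⁻¹ᵁ W) by rw [hz]; exact ho⟩
  -- `Z → H̃` is finite and birational, hence an isomorphism: `Z` is regular
  have hbir₁ : IsBirational ((vanishingIdeal T).subschemeι ≫ p₁) := by
    refine ⟨π ⁻¹ᵁ W, hVd, ?_, ?_⟩
    · rw [Scheme.Hom.comp_preimage]; exact hZd
    · rw [morphismRestrict_comp]
      exact @IsIso.comp_isIso _ _ _ _ _ _ _ hιO h₁
  haveI : IsIso ((vanishingIdeal T).subschemeι ≫ p₁) :=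
    isIso_of_isFinite_of_isBirational _ hnorm hbir₁
  have hZreg : Scheme.IsRegular (vanishingIdeal T).subscheme :=
    hreg.of_iso (inv ((vanishingIdeal T).subschemeι ≫ p₁))
  -- `Z → X` is proper and birational
  refine ⟨(vanishingIdeal T).subscheme, (vanishingIdeal T).subschemeι ≫ p₂, inferInstance, ?_,
    hZreg⟩
  refine ⟨φ ⁻¹ᵁ W, hUd, ?_, ?_⟩
  · rw [Scheme.Hom.comp_preimage, ← hO]; exact hZd
  · rw [morphismRestrict_comp]
    have hιO' : IsIso ((vanishingIdeal T).subschemeι ∣_ p₂ ⁻¹ᵁ (φ ⁻¹ᵁ W)) := by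
      rw [← hO]; exact hιO
    exact @IsIso.comp_isIso _ _ _ _ _ _ _ hιO' h₂

/-- **A finite birational morphism of integral schemes transports resolutions down**
(universe-polymorphic form): if `φ : X → H` is finite and birational and `H` has a resolution
`π : H̃ → H`, then `X` has one, namely the reduced closure in `H̃ ×_H X` of the part over a dense
open `W ⊆ H` where `π` and `φ` are isomorphisms (it is a copy of the normal `H̃`,
`isIso_of_isFinite_of_isBirational`). [cite: DeJong1996, 4.20–4.21, pp. 73–74] -/
theorem hasResolution_of_isFinite_of_isBirational {X H : Scheme.{u}} [IsIntegral X]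
    [IsIntegral H] (φ : X ⟶ H) [IsFinite φ] (hφ : IsBirational φ)
    (hH : Scheme.HasResolution H) : Scheme.HasResolution X := by
  obtain ⟨H', π, hπ⟩ := hH
  haveI := hπ.isProper
  haveI : IsReduced H' := hπ.isRegular.isReduced
  haveI : IsIntegral H' := hπ.isBirational.isIntegral
  have hnorm : ∀ y : H', IsIntegrallyClosed (H'.presheaf.stalk y) := fun y =>
    haveI := hπ.isRegular y
    isIntegrallyClosed_of_isRegularLocalRing _
  obtain ⟨Uπ, hUπ, -, hisoπ⟩ := hπ.isBirational
  obtain ⟨Uφ, hUφ, -, hisoφ⟩ := hφ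
  have hW : Dense ((Uπ ⊓ Uφ : H.Opens) : Set H) := by
    rw [Opens.coe_inf]; exact hUπ.inter_of_isOpen_right hUφ Uφ.isOpen
  exact hasResolution_of_isPullback (IsPullback.of_hasPullback π φ) hnorm hπ.isRegular (Uπ ⊓ Uφ)
    hW.nonempty (isIso_morphismRestrict_of_le π hisoπ inf_le_left)
    (isIso_morphismRestrict_of_le φ hisoφ inf_le_right)

/-- **A finite birational morphism of integral schemes transports resolutions down.** If
`φ : X → H` is finite and birational and `H` has a resolution `π : H̃ → H`, then `X` has one: the
reduced closure `Z` in `H̃ ×_H X` of the part over a dense open `W ⊆ H` where `π` and `φ` are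
isomorphisms is integral, finite and birational over the regular (hence normal,
`isIntegrallyClosed_of_isRegularLocalRing`) integral `H̃`, so `Z ≅ H̃` by
`isIso_of_isFinite_of_isBirational`; and `Z → X` is proper (closed in the base change of the
proper `π`) and an isomorphism over the dense open `φ⁻¹ W`, with non-empty hence dense preimage
in the irreducible `Z`. [folklore; cite: StacksProject, Tag 035Q; DeJong1996, 4.20–4.21] -/
theorem stub_finiteBirationalTransfer : ∀ (X H : AlgebraicGeometry.Scheme.{0}) [AlgebraicGeometry.IsIntegral X] [AlgebraicGeometry.IsIntegral H] (φ : X ⟶ H), AlgebraicGeometry.IsFinite φ → Literature.AlgebraicGeometry.Resolution.IsBirational φ → Literature.AlgebraicGeometry.Resolution.Scheme.HasResolution H → Literature.AlgebraicGeometry.Resolution.Scheme.HasResolution X := by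
  intro X H _ _ φ hfin hbir hres
  haveI := hfin
  exact hasResolution_of_isFinite_of_isBirational φ hbir hres

end Summit.ResolutionOfSingularities.ResolutionOfSingularities.Theorems.WeightedThesis.FiniteBirationalTransfer

end
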